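import Summits.ResolutionOfSingularities.ResolutionOfSingularities.Theorems.MarkedTransferCampaignW13RFlatAffineParity
import HarnessLib

/-!
# [OURS · L1 W1.3] The positive class in EVERY characteristic: knock-out weighted-homogeneous modulo `p` of non-zero weighted
# degree ⇒ POS (Diff-form), any prime power exponent (seat res-L1-s13-pv-1, g2)

LADDER-RESOLUTION rung L (rescue), cell `res-hironaka`, RESCUE-SEED slot W1.3 (architecture bypass, reading R-flat), F7′ row 1.
All-characteristic companion of p504584 (`p = 2`, affine parity). Setting: `K` a commutative ring of characteristic `p` (prime),
`σ` finite, `g, τ ∈ K[x_σ]`, an exponent `q = p^e` with `e ≥ 1`, the knock-out `T = g − τ^q`.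

**Weighted Euler criterion** (`tail_pow_mem_pAlgPiece_of_weightedDegree`). If there are weights `w : σ → ℕ` and a UNIT `c ∈ K`
such that every monomial `x^m` of `T` has weighted degree `Σ_i w_i m_i ≡ c` in `K` (i.e. `T` is weighted-homogeneous MODULO `p`
of a weighted degree not divisible by `p`), then `τ^q ∈ Diff^{(1)}((g)) ⊆ ℘_alg(((g), b), 1)` for every exponent `b ≥ 2`, in
particular `b = q`: weighted Euler `Σ_i w_i x_i ∂_i T = c·T` (`weightedEuler_of_weightedDegree`), `∂_i(τ^q) = q·τ^{q−1}∂_iτ = 0`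
in characteristic `p` (`pderiv_sub_pow_primePow`), so `T = c⁻¹ Σ_i w_i x_i ∂_i g ∈ 𝔪·Diff^{(1)}((g))` and `τ^q = g − T`. At
`p = 2`, `c = 1` this is exactly affine parity. The NEG witnesses of p501051 / p503083 / p507090 / p508341 all violate it (their
knock-outs mix weighted degrees modulo `p` for every weight).

HONEST FRAMING. OURS statements about the OURS bypass objects (bound algebraic `℘`, row 003 U17_2; candidate U17_4 not used);
nothing here is a statement of H. Hironaka's manuscript [Hironaka2017] (2017-03-23, lit key `paper:url-3343fd9e678b`); no claim
about resolution of singularities in positive characteristic; AI bookkeeping weaker than expert review. All decls `[folklore]`,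
sorry-free.
-/

noncomputable section

set_option linter.dupNamespace false -- mandated namespace of this single-conjunct summit

namespace Summit.ResolutionOfSingularities.ResolutionOfSingularities.Theorems.Campaign.W13

open MvPolynomial
open Literature.AlgebraicGeometry.Resolution
open Literature.AlgebraicGeometry.Hironaka2017
open Literature.AlgebraicGeometry.Hironaka2017.S09LLUED (LLChainData)

universe u

section WeightedEuler

variable (K : Type u) [CommRing K] {σ : Type} [Fintype σ]

/-- **Weighted Euler identity for a polynomial weighted-homogeneous modulo the characteristic**: if every monomial `x^m` of `T`
has `Σ_i w_i m_i = c` in `K`, then `Σ_i w_i·(x_i ∂_i T) = c·T` (Mathlib `X_mul_pderiv_monomial`). [folklore] -/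
theorem weightedEuler_of_weightedDegree (w : σ → ℕ) (c : K) (T : MvPolynomial σ K)
    (hT : ∀ m ∈ T.support, ((∑ i, w i * m i : ℕ) : K) = c) :
    ∑ i, w i • (X i * pderiv i T) = c • T := by
  have key : ∀ m ∈ T.support,
      ∑ i, w i • (X i * pderiv i (monomial m (coeff m T))) = c • monomial m (coeff m T) := by
    intro m hm
    simp_rw [X_mul_pderiv_monomial, smul_smul, ← Finset.sum_smul]
    rw [nsmul_eq_mul, smul_eq_C_mul, ← map_natCast (C : K →+* MvPolynomial σ K), hT m hm]
  calc ∑ i, w i • (X i * pderiv i T)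
      = ∑ i, w i • (X i * pderiv i (∑ m ∈ T.support, monomial m (coeff m T))) := by
        rw [support_sum_monomial_coeff]
    _ = ∑ i, ∑ m ∈ T.support, w i • (X i * pderiv i (monomial m (coeff m T))) := by
        refine Finset.sum_congr rfl fun i _ => ?_
        rw [map_sum, Finset.mul_sum, Finset.smul_sum]
    _ = ∑ m ∈ T.support, ∑ i, w i • (X i * pderiv i (monomial m (coeff m T))) := Finset.sum_comm
    _ = ∑ m ∈ T.support, c • monomial m (coeff m T) := Finset.sum_congr rfl key
    _ = c • T := by rw [← Finset.smul_sum, support_sum_monomial_coeff]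

variable (p : ℕ) [hp : Fact p.Prime] [CharP K p]

omit [Fintype σ] hp in
/-- In characteristic `p`, `q`-th powers with `q = p^e`, `e ≥ 1`, are `∂`-constants: `∂_i(τ^q) = 0`, so the knock-out `g − τ^q`
has the same first partials as `g`. [folklore] -/
theorem pderiv_sub_pow_primePow (i : σ) (g τ : MvPolynomial σ K) {e : ℕ} (he : 1 ≤ e) :
    pderiv i (g - τ ^ p ^ e) = pderiv i g := by
  have hcast : ((p ^ e : ℕ) : MvPolynomial σ K) = 0 := by
    rw [Nat.cast_pow, CharP.cast_eq_zero, zero_pow (by omega)]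
  rw [map_sub, sub_eq_self, pderiv_pow, hcast, zero_mul, zero_mul]

omit hp in
/-- Under the weighted-degree hypothesis the knock-out is a value of order-`≤ 1` operators on `(g)`:
`g − τ^q = c⁻¹·Σ_i w_i x_i ∂_i g ∈ Diff^{(1)}((g))` (`c` a unit of `K`). [folklore] -/
theorem sub_pow_mem_diffIdeal_one_of_weightedDegree (g τ : MvPolynomial σ K) {e : ℕ} (he : 1 ≤ e) (w : σ → ℕ)
    {c : K} (hc : IsUnit c) (hdeg : ∀ m ∈ (g - τ ^ p ^ e).support, ((∑ i, w i * m i : ℕ) : K) = c) :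
    g - τ ^ p ^ e ∈ diffIdeal K 1 (Ideal.span {g}) := by
  obtain ⟨u, rfl⟩ := hc
  have hE := weightedEuler_of_weightedDegree K w (u : K) (g - τ ^ p ^ e) hdeg
  have hT : g - τ ^ p ^ e = ((u⁻¹ : Kˣ) : K) • ∑ i, w i • (X i * pderiv i (g - τ ^ p ^ e)) := by
    rw [hE, smul_smul, Units.inv_mul, one_smul]
  rw [hT]
  refine Submodule.smul_of_tower_mem _ _ (Ideal.sum_mem _ fun i _ => ?_)
  rw [pderiv_sub_pow_primePow K p i g τ he]
  exact Submodule.smul_of_tower_mem _ (w i) (mul_pderiv_mem_diffIdeal K i (X i) g le_rfl)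

omit hp in
/-- **WEIGHTED EULER CRITERION (POS, Diff-form), every characteristic.** `K` of characteristic `p`, `q = p^e` (`e ≥ 1`), any
`g, τ`, any exponent `b ≥ 2`: if the knock-out `g − τ^q` is weighted-homogeneous modulo `p` of a weighted degree that is a unit
of `K`, then `τ^q ∈ Diff^{(1)}((g)) ⊆ ℘_alg(((g), b), 1)` (p475548 `diffIdeal_le_pAlgPiece_one`). No canonical-class hypothesis,
no integral closure. [folklore] -/
theorem tail_pow_mem_pAlgPiece_of_weightedDegree (g τ : MvPolynomial σ K) {e : ℕ} (he : 1 ≤ e) {b : ℕ} (hb : 2 ≤ b)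
    (w : σ → ℕ) {c : K} (hc : IsUnit c)
    (hdeg : ∀ m ∈ (g - τ ^ p ^ e).support, ((∑ i, w i * m i : ℕ) : K) = c) :
    τ ^ p ^ e ∈ Campaign.pAlgPiece K (Ideal.span {g}) b 1 := by
  have h : τ ^ p ^ e = g - (g - τ ^ p ^ e) := by ring
  rw [h]
  refine diffIdeal_le_pAlgPiece_one K _ (by omega) (show 1 < b by omega) ?_
  exact Ideal.sub_mem _ (le_diffIdeal K 1 _ (Ideal.subset_span rfl))
    (sub_pow_mem_diffIdeal_one_of_weightedDegree K p g τ he w hc hdeg)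

/-- The same in the v4 schema at the hypersurface exponent `b = q = p^{d.e}`: every chain datum `d` with `d.e ≥ 1` whose total
knock-out `g(0) − tail^q` is weighted-homogeneous modulo `p` of unit weighted degree satisfies `RFlatTailPow p K ((g(0)), q) d`.
[folklore] -/
theorem rFlatTailPow_of_weightedDegree (d : LLChainData (MvPolynomial σ K)) (he : 1 ≤ d.e) (w : σ → ℕ) {c : K}
    (hc : IsUnit c) (hdeg : ∀ m ∈ (d.g 0 - d.tail ^ p ^ d.e).support, ((∑ i, w i * m i : ℕ) : K) = c) :
    Campaign.RFlatTailPow p K (Ideal.span {d.g 0}) (p ^ d.e) d := by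
  rw [Campaign.RFlatTailPow]
  refine tail_pow_mem_pAlgPiece_of_weightedDegree K p (d.g 0) d.tail he ?_ w hc hdeg
  calc 2 ≤ p := hp.out.two_le
    _ = p ^ 1 := (pow_one p).symm
    _ ≤ p ^ d.e := Nat.pow_le_pow_right hp.out.pos he

end WeightedEuler

end Summit.ResolutionOfSingularities.ResolutionOfSingularities.Theorems.Campaign.W13

end
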